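import Summits.QuantumFields.YangMills.Theorems.BalabanUVNodesN07Lemma1CrossingBondsAtRecord
import Summits.QuantumFields.YangMills.Theorems.BalabanUVNodesN07Lemma1BlockGauge
import HarnessLib

/-!
# DAG node N07 [B11] — Sect. F (160) CASE II, GAUGE-HYPOTHESIS-FREE: Lemma 1 of [6] (1.25) for EVERY far-face crossing bond in the (0.4) reading,
# IN THE BLOCK-WISE GAUGE TRIVIAL AT THE CENTRES (`…N07Lemma1BlockGauge`), `SU(N)` and at the record — the `τ` of `…CrossingBonds(AtRecord)` DISCHARGED
# as `(d−1)(L−1)·a` from the same plaquette smallness, the block averages untouched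

Cell `pub-ymgap` (HUMAN RULINGS D-0062 ∕ D-0149 ∕ D-0154), width seat `pub-ymgap-dag-n07-w5` g0, 2026-08-28.  `--kind proof --supports
stmt-QuantumFields-20542 --as helper` (K1⁷; count-neutral helper on the N07 [B11] row; dag-lead WIDTH-209 N07 piece 1b, DEDUP-382; fifth file of this seat).

THE PRINT.  [6] = T. Bałaban, CMP **99** (1985) 75–102 `[Balaban1985RegularSpaces]`, Lemma 1 (1.24)–(1.25) p. 79 «Let V₀, V′V₀ satisfy the condition (1.7)
for k = 1 …, and let (R(V₀)V′)(Γ_{y,x}) = 1 for x ∈ B(y), |V̄′V̄₀ − V̄₀| < α₁ … Then … |V′ − 1| < 4d²α₀ + α₁ on Ω₁. (1.25)», (1.14)–(1.15) p. 78; [B11] = CMP **102**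
(1985) 277–309 `[Balaban1985Variational]`, (160) p. 303 second case; [I] = CMP **109** (1987) 249–301 `[Balaban1987RG1]`, (0.4) p. 253; [B7] = CMP **98** (1985)
17–51 `[Balaban1985Averaging]`, (11) p. 19.

WHAT THIS FILE DOES (by-name composition of this seat's four landed files; nothing of [B11] ∕ [6] beyond Lemma 1's elementary bookkeeping asserted).
* ★★★ `exists_gauge_crossingBond_le` (`SU(N)`, generic torus `P`, standing range): for every `U` there is a gauge transformation `g`, trivial at every block
  centre and moving no block average (`avgFun ℰ (U^g) = avgFun ℰ U` for every small-loop average `ℰ`), such that for every coarse bond `c` whose three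
  blocks `B(c₋ − e_μ) ∪ B(c₋) ∪ B(c₊)` carry `a`-small plaquettes (`t := ((d+2)L)²∕4·a < δ_N`) every far-face crossing bond obeys
  `dist1 (U^g⟨blockSite c₋ r, μ⟩) ≤ dist1 (Ū(c)) + 7t + (d+1)(L−1)·(d−1)(L−1)·a` — Lemma 1 (1.25) in the (0.4) reading with `α₁ = dist1 (Ū(c))` and NO
  gauge hypothesis left (`τ = (d−1)(L−1)·a` from `…N07Lemma1BlockGauge.exists_blockwiseGauge`).
* ★★★ `exists_gauge_crossingBond_le_at_record` — at `Node00.avOfRecord F N K j`: the same with `dist1 (M(U)(c)) ≤ α` ⇒ `≤ α + 7t + (d+1)(L−1)(d−1)(L−1)·a`;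
  combined with p607031 `exists_dataAxialStep` (coarse axial gauge of `M(U)`, `α = (d−1)nδ̄` on a box) this is [B11] (147) + (160) case II at the record,
  bond by bond, in the tree's constants.

HONEST FRAMING (binding).  Count-neutral helper; the plaquette smallness `a`, the guard and (at the record) the coarse smallness `α` are HYPOTHESES; the
far-field (155) and the Landau `u` ∕ its shear ((156), GAP-STATED(avg-universality)) are NOT here; constants are the tree's crude ones (print: `4d²α₀`).
Tokens ∕ stub 1 ∕ K0⁷ ∕ K1⁷ NOT closed; N07 NOT discharged (5∕27 unmoved); one finite `T⁴` programme at fixed `ε`, Bałaban AS PRINTED — R4 closes rung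
`BalabanLadder.UV` only; no summit statement is proved by this seat; NOT continuum ∕ ℝ⁴ ∕ OS ∕ mass gap ∕ Clay.  No `sorry`, no `def`, no `instance`, no `notation`.
-/

noncomputable section

namespace Summit.QuantumFields.YangMills.BalabanUVNodes.N07Lemma1CrossingBondsGauged

open Literature.MathematicalPhysics.QuantumFieldTheory.Balaban1983to89
open T4Continuum AveragingRT BlockAveraging ExpMeanLog
open GaugeField (gaugeAct)
open N07Lemma1BlockGauge (exists_blockwiseGauge)
open N07Lemma1CrossingBondsAtRecord (dist1_crossingBond_le_avg_add)
open N07Lemma1CrossingFlat (dist1_plaqHol_gaugeAct_eq)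

section SUN

open scoped Matrix.Norms.L2Operator

variable {n : Type*} [Fintype n] [DecidableEq n] [Nonempty n] {P : Params} {j : ℕ}

/-- ★★★ **LEMMA 1 OF [6] (1.25) FOR THE (0.4) AVERAGING, every far-face crossing bond, NO gauge hypothesis** (`SU(N)`, generic torus, standing range): in
the block-wise gauge trivial at the centres, for every coarse bond whose three blocks carry `a`-small plaquettes (`t < δ_N`), every far-face crossing bond
`⟨blockSite c₋ r, μ⟩` (`r_μ = L − 1`) obeys `dist1 ≤ dist1 (Ū(c)) + 7t + (d+1)(L−1)(d−1)(L−1)·a`, and the gauge moves no block average.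
[cite: Balaban1985RegularSpaces, Lemma 1 (1.24)-(1.25) p.79, (1.14)-(1.15) p.78; Balaban1987RG1, (0.4) p.253] -/
theorem exists_gauge_crossingBond_le (hj : j + 1 ≤ P.m + P.K) (U : GaugeField P j (Matrix.specialUnitaryGroup n ℂ)) :
    ∃ g : GaugeTransf P j (Matrix.specialUnitaryGroup n ℂ),
      (∀ y : Site P (j + 1), g (emb y) = 1) ∧
      (∀ ℰ : LoopAverage (Matrix.specialUnitaryGroup n ℂ), avgFun ℰ (gaugeAct g U) = avgFun ℰ U) ∧
      ∀ {a : ℝ}, 0 ≤ a → ∀ c : PBond P (j + 1),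
        (∀ q : Plaq P j, (blockOf q.src = c.src.unshift c.dir ∨ blockOf q.src = c.src ∨ blockOf q.src = c.tgt) →
          dist1 (GaugeField.plaqHol U q) < a) →
        ((((P.d + 2) * P.L : ℕ) : ℝ) ^ 2 / 4) * a < deltaSU n →
        ∀ (r : Fin P.d → Fin P.L), (r c.dir : ℕ) = P.L - 1 → ∀ σ σ' : Equiv.Perm (Fin P.d),
          dist1 (gaugeAct g U ⟨Site.blockSite c.src r, c.dir⟩) ≤
            dist1 (avgFun (expMeanLogSU (n := n)) U c) + 7 * (((((P.d + 2) * P.L : ℕ) : ℝ) ^ 2 / 4) * a) +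
              (((P.d + 1) * (P.L - 1) : ℕ) : ℝ) * ((((P.d - 1 : ℕ) : ℝ) * ((P.L - 1 : ℕ) : ℝ)) * a) := by
  obtain ⟨g, hcentre, hint, havg⟩ := exists_blockwiseGauge hj U
  refine ⟨g, hcentre, fun ℰ => havg (blockAvg ℰ), ?_⟩
  intro a ha c hU ht r hr σ σ'
  -- plaquette smallness is gauge invariant
  have hU' : ∀ q : Plaq P j, (blockOf q.src = c.src.unshift c.dir ∨ blockOf q.src = c.src ∨ blockOf q.src = c.tgt) →
      dist1 (GaugeField.plaqHol (gaugeAct g U) q) < a := by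
    intro q hq
    rw [T4ReTrLipUnitary.plaqHol_gaugeAct, GaugeGroup.dist1_conj]
    exact hU q hq
  -- within-block bonds of `U^g` in the two blocks of `c`
  have hτ : 0 ≤ (((P.d - 1 : ℕ) : ℝ) * ((P.L - 1 : ℕ) : ℝ)) * a := by positivity
  have hintc : ∀ b : PBond P j, blockOf b.src = blockOf b.tgt → (blockOf b.src = c.src ∨ blockOf b.src = c.tgt) →
      dist1 (gaugeAct g U b) ≤ (((P.d - 1 : ℕ) : ℝ) * ((P.L - 1 : ℕ) : ℝ)) * a := by
    intro b hb hbc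
    rcases hbc with h | h
    · exact hint a ha c.src (fun q hq => hU q (Or.inr (Or.inl hq))) b h (hb ▸ h)
    · exact hint a ha c.tgt (fun q hq => hU q (Or.inr (Or.inr hq))) b h (hb ▸ h)
  have hmain := dist1_crossingBond_le_avg_add ha hj c hU' ht hτ hintc r hr σ σ'
  have havg' : avgFun (expMeanLogSU (n := n)) (gaugeAct g U) c = avgFun (expMeanLogSU (n := n)) U c :=
    congrFun (havg (blockAvg (expMeanLogSU (n := n)))) c
  rw [havg'] at hmain
  exact hmain

end SUN

section Record

open scoped Matrix.Norms.L2Operator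
open Node00 (avOfRecord avOfRecord_avg)

variable {F : T4Family} {N : ℕ} [NeZero N] {K j : ℕ}

/-- ★★★ **[B11] (160) CASE II AT THE RECORD, bond by bond, no gauge hypothesis**: for a fine field `U` on `T^{(j)}` of the torus `F.P K` there is a
gauge transformation `g` trivial at the block centres with `M(U^g) = M(U)` (`Node00.avOfRecord`) such that for every coarse bond `c` with `a`-small
plaquettes on its three blocks, guard `t < δ_N`, and `dist1 (M(U)(c)) ≤ α` (p607031 `exists_dataAxialStep` supplies `α = (d−1)nδ̄` on a box after the coarse
axial re-gauging, which commutes with this statement since `M(U^g) = M(U)`): every far-face crossing bond of `U^g` has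
`dist1 ≤ α + 7t + (d+1)(L−1)(d−1)(L−1)·a`. [cite: Balaban1985Variational, (147) p.301, (160) p.303; Balaban1985RegularSpaces, Lemma 1 (1.25) p.79] -/
theorem exists_gauge_crossingBond_le_at_record (hj : j + 1 ≤ (F.P K).m + (F.P K).K) (U : GaugeField (F.P K) j (Node00.SU N)) :
    ∃ g : GaugeTransf (F.P K) j (Node00.SU N),
      (∀ y : Site (F.P K) (j + 1), g (emb y) = 1) ∧
      (avOfRecord F N K j).avg (gaugeAct g U) = (avOfRecord F N K j).avg U ∧
      ∀ {a α : ℝ}, 0 ≤ a → ∀ c : PBond (F.P K) (j + 1),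
        (∀ q : Plaq (F.P K) j, (blockOf q.src = c.src.unshift c.dir ∨ blockOf q.src = c.src ∨ blockOf q.src = c.tgt) →
          dist1 (GaugeField.plaqHol U q) < a) →
        (((((F.P K).d + 2) * (F.P K).L : ℕ) : ℝ) ^ 2 / 4) * a < deltaSU (Fin N) →
        dist1 ((avOfRecord F N K j).avg U c) ≤ α →
        ∀ (r : Fin (F.P K).d → Fin (F.P K).L), (r c.dir : ℕ) = (F.P K).L - 1 →
          dist1 (gaugeAct g U ⟨Site.blockSite c.src r, c.dir⟩) ≤
            α + 7 * ((((((F.P K).d + 2) * (F.P K).L : ℕ) : ℝ) ^ 2 / 4) * a) +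
              ((((F.P K).d + 1) * ((F.P K).L - 1) : ℕ) : ℝ) * (((((F.P K).d - 1 : ℕ) : ℝ) * (((F.P K).L - 1 : ℕ) : ℝ)) * a) := by
  obtain ⟨g, hcentre, havg, hbound⟩ := exists_gauge_crossingBond_le hj U
  refine ⟨g, hcentre, ?_, ?_⟩
  · rw [avOfRecord_avg]
    exact havg _
  · intro a α ha c hU ht hα r hr
    have h := hbound ha c hU ht r hr (Equiv.refl _) (Equiv.refl _)
    rw [avOfRecord_avg] at hα
    linarith

end Record

end Summit.QuantumFields.YangMills.BalabanUVNodes.N07Lemma1CrossingBondsGauged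

end
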